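import Literature.MathematicalPhysics.QuantumFieldTheory.Balaban1983to89.B11Eq90Pullback
import Literature.MathematicalPhysics.QuantumFieldTheory.Balaban1983to89.B11Eq63V0GroupCurrent
import Literature.MathematicalPhysics.QuantumFieldTheory.Balaban1983to89.T4FixedPointResponse
import Literature.Analysis.Complex.GateauxHolomorphicBall
import Literature.Analysis.Complex.OsgoodProofs

/-!
# `Balaban1983to89.B11Eq90V0GroupComposed` — T. Bałaban, *The variational problem and background fields in renormalization group method for lattice gauge theories*, Commun. Math. Phys. **102** (1985) 277–309 [Balaban1985Variational]: (47)–(49) p. 285, (54)–(57) p. 286, (80) p. 290, (90)–(96) pp. 291–292, Prop. 4 (97)–(98) pp. 292–293 — THE V₀-GROUP OF `W = (δ/δA′)V` AT `A′`, COMPOSED WITH THE Sect. C MAP (47): print's (90) INCLUDING its `−𝔇*(A′)H*` term, the commutator group (91)–(96) and p. 292's HD(A′)-insertion terms, ALL AT ONCE as the pullback of this lineage's V₀-current along (47); with (47) FRÉCHET-HOLOMORPHIC ON ITS BALL proved in Literature, the (63) pairing certificate against r08's whole `V₀` of (26), differentiability/analyticity, and the (98)-form slot under the displayed column letter of `H𝔇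(A′)`

statement-level skeleton of published theorems with citation tags; proofs where landed; nothing here is a claim about the Yang–Mills mass gap

PDF held: `paper:balaban1985-cmp102-variational-background` (journal page = PDF page + 276); pp. 282–293 read from the `lit read` text layer by
this seat (2026-08-21); displays as transcribed in `B11Eq26ActionExpansion` ((26), (30)), `B11Eq63FunctionalDerivative` ((63)),
`B11Eq85FirstDerivative` ((90)), `B11Eq174Chart` ((47)/(50) as `solA`), `B11Eq115Space` ((115)).

CITATION HEADER (lean-in-tree rule 2026-08-18).  WHAT IS REPRODUCED: groups W₄ (90) and W₅ ((91)–(96) + the HD(A′)-insertions of p. 292) of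
r08's `B11Prop4Assembly.TermwiseDatum` AT `A′` — the last term `V₀(A′ − HD(A′))` of (80) differentiated with respect to `A′` —, for pub-balaban
NE9 letter (L3) (INTERFACE REQUEST NE9 (L3), HOME/INBOX.md l.13889; W-slot of the owner's `NE9CurChartOfBackground.cur_chart_exists_of_W_H126`,
whose T-slot is the SAME `fun A′ => A′ + solA H 0 C 0 ε_C A′`).  THE PRINT, verbatim.  p. 285 (47)–(49): *«We will construct the linearizing
transformation in the form A = A′ − HD(A′), (47) … C_j(LʲηA′ − LʲηHD(A′)) = D(A′) on Λ_j. (49)»*; p. 286: *«This solution … is an analytic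
function of A′. … |A| ≦ |A′| + B₀(Lʲη)⁻¹4C₂|A′|²₍₋₁₎ < (ε₃ + 4C₂B₀ε₃²)(Lʲη)⁻¹ < 2ε₃(Lʲη)⁻¹ on Ω_j. (57)»*; p. 290 (80): *«V(A′) = −⟨HD₃(A′), J⟩ −
⟨A′, Δ_π HD(A′)⟩ + ½⟨HD(A′), Δ_π HD(A′)⟩ + V₀(A′ − HD(A′)). (80) It is analytic in A′ …»*; p. 291 (90): *«(δ/δA′(b))V′₀(A′ − HD(A′)) =
Σ_{p∈st(b)}((∂/∂A(b))V′₀)(A′ − HD(A′), ∂p) − 𝔇*(A′)H*Σ_{p∈st(·)}((∂/∂A(·))V′₀)(A′ − HD(A′), ∂p)»*; p. 292: *«When we make the change of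
variables (47), we get many terms. The functional derivative of these terms can be easily estimated by O(1)ε₃³(Lʲη)⁻³, if the covariant
derivative in (39) acts on HD(A′). … the other terms are obtained by replacing some A′ in the commutator by −HD(A′).»*; Prop. 4 p. 292:
*«The functional derivative of V(A′) is an analytic function on this space, and satisfies the estimate … (98)»*.

WHAT IS DEFINED AND PROVED (sorry-free; axioms `propext`/`Classical.choice`/`Quot.sound`; two defs with bodies; no `Prop`-valued definition,
no new named fact).
§1 **`T47 H C ε_C := fun A′ => A′ + solA H 0 C 0 ε_C A′`** — (47) on `Space115` with `H : 𝒳 →L[ℂ] Space115 …`, `C : Space115 … → 𝒳` letters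
   (the cell's `HopAd`/`H1LatticeCLM` and `Cc`, whose Sect. C `Regime` is leaf-03's `regime_sectC`); under a Sect. C regime `Regime H 0 C b 0 C₂
   c₄ 0 a_C ε_C`: `norm_solA_le` (‖HD(A′)‖ ≤ ε_C), **`T47_sub_self`** ((48)/(49): `A − A′ = −H(C(A))`), `T47_zero`, `norm_T47_lt`,
   **`norm_T47_le`** ((57) in the form `‖A‖ ≤ ‖A′‖/(1 − 4bC₂(ε_C + a_C))`, from `T4FixedPointResponse.norm_solution_sub_le_data`).
§2 **`differentiableOn_solA`**, **`differentiableOn_T47`**, **`analyticOnNhd_T47`** — (47) IS FRÉCHET-HOLOMORPHIC (indeed analytic) ON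
   `‖A′‖ < a_C`, IN LITERATURE: lit-balaban's `Regime.solA_differentiableOn` (holomorphy along complex lines) + boundedness `‖HD(A′)‖ ≤ ε_C` +
   the tree's Graves–Taylor–Hille–Zorn theorem `Literature.Analysis.Complex.GateauxHolomorphic.differentiableOn_of_gateaux_of_bounded`, then
   Osgood (`Literature.Analysis.Complex.SCV.analyticOnNhd_of_differentiableOn`, finite-dimensional carrier); `fderiv_T47` (`T′ = 1 + (−HD)′`).
§3 **`curV0full ρ τ U₀ H C ε_C := pullCur ρ τ (T47 H C ε_C) (curV0 ρ τ U₀)`** : `Space115 L η lev₀ lev₁ Dc → NegSize L η lev₀ 3 𝔸`;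
   `differentiable_V0` (r08's `V₀` of (26) is entire, via (30) `eq30a` + `contDiff_V0p`); **`pair27_curV0full`** — THE (63) CERTIFICATE:
   `⟨curV0full(A′), δ⟩ = (d/dt) V₀(T(A′ + tδ))|_{t=0}` for `‖A′‖ < a_C` (`V₀ = B11Eq26ActionExpansion.V0`, tracial `τ`, `τ(ρ(ℓ)X) = ℓ X`, `d ≥ 4`)
   — i.e. `curV0full` IS `(δ/δA′)[V₀(A′ − HD(A′))]`, UNIQUELY by `B11Eq90Transpose.eq_of_pair27_eq`; **`differentiableOn_curV0full`**,
   **`analyticOnNhd_curV0full`** on `ball 0 a_C`.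
§4 `kernel_add`, `kernel_id_apply`, `colSum_kernel_id_le_one`, **`colSum_kernel_fderiv_T47_le`** (columns of `T′(A′)` ≤ `1 + Θ` from the column
   letter `Θ` of `(−HD)′(A′) = −H𝔇(A′)`), **`prop4Hyp_curV0full`** / **`quadAnalytic_curV0full`** — the W-slot clauses of the owner's theorem for
   this group: from `QuadAnalytic (curV0 ρ τ U₀) C_V R_V` (PROVED under its displays in `B11Eq63V0GroupCurrent.quadAnalytic_curV0`), the Sect. C
   regime, `Prop4Hyp C`, the column letter `Θ` on the ball and `R′ ≤ a_C`, `R′ ≤ (1 − 4bC₂(ε_C + a_C))R_V`: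
   `QuadAnalytic (curV0full …) (‖ρ‖‖τ‖(1 + Θ)C_V(1 − 4bC₂(ε_C + a_C))⁻²) R′ ∧ AnalyticOnNhd ℂ (curV0full …) {‖Y‖ < R′}`.

HONEST SCOPE — what is NOT claimed.  (i) THIS IS THE V₀-GROUP (W₄ + W₅ of (85)) of (L3) `W` AT `A′` — the groups (85) `−𝔇₃*(A′)H*J`, (88),
(89) of (80) need the letters `J` and `Δ_π` AT THE CARRIER and are NOT in this file; so this is STILL NOT (L3) `W`.  (ii) The column letter `Θ`
(weighted ℓ¹-columns of the kernel of `H𝔇(A′)`) is DISPLAYED — in print it follows from the kernel bounds (46) and (73) with their exponential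
decay; no uniformity in the lattice is claimed here; the Sect. C regime and `Prop4Hyp C` are hypotheses (inhabited by leaf-03's `regime_sectC`,
`prop4Hyp_Cc`).  (iii) `ρ` a letter with its dualising display.  (iv) DIVERGENCE D-pv27.4 inherited (abstract `τ`; `η`, `L` real).  (v) NOT
summit progress (cell pub-balaban: NE9 NOT PRINTED / NOT PROVED; «NE9 ⇐ the named binders»; spine PROVED 0/9; HONEST DEPENDENCY: continuum YM
on T⁴ ⇐ BetaPertH ∧ nine spine estimates (0/9 proved); BetaPertH ⇐ (D1) ∧ (D4) ∧ CAP+tail; G-an2-4 gates asym, D1 and NE2/3/4).  Unit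
`b2b-balaban-t4-ne9-formalise-leaf-05` (NE9 crux-team leaf prover, gen 65).  Imports `B11Eq90Pullback`, `B11Eq63V0GroupCurrent` (this lineage),
`T4FixedPointResponse` (lit), `Literature.Analysis.Complex.GateauxHolomorphicBall`, `…OsgoodProofs`; modifies nothing.
-/

noncomputable section

open NormedSpace Complex Metric Set Finset Filter Topology

namespace Literature.MathematicalPhysics.QuantumFieldTheory.Balaban1983to89.B11Eq90V0GroupComposed

open Literature.MathematicalPhysics.QuantumFieldTheory.Balaban1983to89.B9Eq39Adjoint (bondPair posPlaq)
open Literature.MathematicalPhysics.QuantumFieldTheory.Balaban1983to89.B11Prop6Scheme (mapT mapT_158 Prop4Hyp)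
open Literature.MathematicalPhysics.QuantumFieldTheory.Balaban1983to89.B11Eq174Chart (solA Regime)
open Literature.MathematicalPhysics.QuantumFieldTheory.Balaban1983to89.B11Eq26ActionExpansion (V0 V0p eq30a)
open Literature.MathematicalPhysics.QuantumFieldTheory.Balaban1983to89.B11Eq90V0primeBond (contDiff_V0p)
open Literature.MathematicalPhysics.QuantumFieldTheory.Balaban1983to89.B11Eq90V0primeCurrent (Tsh Ucur curL curL_apply flat115
  flat115_apply differentiable_curV0prime)
open Literature.MathematicalPhysics.QuantumFieldTheory.Balaban1983to89.B11Eq96CommutatorCurrent (differentiable_curComm)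
open Literature.MathematicalPhysics.QuantumFieldTheory.Balaban1983to89.B11Eq63V0GroupCurrent (curV0 bondPair_curV0)
open Literature.MathematicalPhysics.QuantumFieldTheory.Balaban1983to89.B11Eq90Transpose
open Literature.MathematicalPhysics.QuantumFieldTheory.Balaban1983to89.B11Eq90Pullback
open B9SectCLatticeCarrier (Bond)
open B4Sect5Torus (TSite)
open B11Eq115Space

variable {𝔸 : Type*} [NormedRing 𝔸] [NormedAlgebra ℂ 𝔸]
variable {d : ℕ} {Pd : Fin d → ℕ} {L η : ℝ} [Fact (0 < L)] [Fact (0 < η)] {lev₀ : Bond d Pd → ℕ} {κ' : Type*} [Fintype κ']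
  {lev₁ : κ' → ℕ} {Dc : (Bond d Pd → 𝔸) →ₗ[ℂ] (κ' → 𝔸)}
variable {𝒳 : Type*} [NormedAddCommGroup 𝒳] [NormedSpace ℂ 𝒳]

/-! ## §1 The Sect. C map (47) `A = A′ − HD(A′)` on the space (115) -/

/-- **THE Sect. C MAP (47) ON THE SPACE (115)**: `A′ ↦ A = A′ − HD(A′)` with `−HD(A′) = solA H 0 C 0 ε_C A′` the solution of (49)/(50)
`X = −H(C(X + A′))` selected by lit-balaban's `B11Eq174Chart.solA` (the SAME object as in the owner's `cur_chart_exists_of_W`, where it is the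
`T`-slot `fun A′ => A′ + solA H 0 C 0 ε_C A′`); `H : 𝒳 →L[ℂ] Space115 …` and `C : Space115 … → 𝒳` are letters (the cell's `HopAd`/`H1LatticeCLM`
and `Cc`). [cite: Balaban1985Variational, (47) p.285, (49)–(50) p.285] -/
def T47 (H : 𝒳 →L[ℂ] Space115 L η lev₀ lev₁ Dc) (C : Space115 L η lev₀ lev₁ Dc → 𝒳) (εC : ℝ)
    (A' : Space115 L η lev₀ lev₁ Dc) : Space115 L η lev₀ lev₁ Dc :=
  A' + solA H 0 C 0 εC A'

/-- Unfolding (47). [cite: Balaban1985Variational, (47) p.285] -/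
theorem T47_apply (H : 𝒳 →L[ℂ] Space115 L η lev₀ lev₁ Dc) (C : Space115 L η lev₀ lev₁ Dc → 𝒳) (εC : ℝ) (A' : Space115 L η lev₀ lev₁ Dc) :
    T47 H C εC A' = A' + solA H 0 C 0 εC A' := rfl

/-- (47) as a function: `T47 = id + solA`. [cite: Balaban1985Variational, (47) p.285] -/
theorem T47_eq (H : 𝒳 →L[ℂ] Space115 L η lev₀ lev₁ Dc) (C : Space115 L η lev₀ lev₁ Dc → 𝒳) (εC : ℝ) :
    T47 H C εC = fun A' : Space115 L η lev₀ lev₁ Dc => A' + solA H 0 C 0 εC A' := rfl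

section RegimeC

variable [FiniteDimensional ℂ 𝔸] {H : 𝒳 →L[ℂ] Space115 L η lev₀ lev₁ Dc} {C : Space115 L η lev₀ lev₁ Dc → 𝒳} {b C₂ c₄ aC εC : ℝ}

/-- Under a Sect. C regime (`Regime H 0 C b 0 C₂ c₄ 0 a_C ε_C`: `‖Hf‖ ≤ b‖f‖`, `C` quadratic-analytic (44), the contraction conditions (52)–(54)):
`‖HD(A′)‖ ≤ ε_C` on `‖A′‖ < a_C` ((51): «|X| < ε₃/B₀»). [cite: Balaban1985Variational, (51) p.285, Prop. 3 p.289] -/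
theorem norm_solA_le (RC : Regime H 0 C b 0 C₂ c₄ 0 aC εC) {A' : Space115 L η lev₀ lev₁ Dc} (hA' : ‖A'‖ < aC) :
    ‖solA H 0 C 0 εC A'‖ ≤ εC :=
  (RC.solA_mem (J := 0) (by rw [norm_zero]) hA').1

/-- **(48)/(49): `A − A′ = −HD(A′)` with `D(A′) = C(A)`** — the selected solution solves `X = −H(C(X + A′))`, i.e. `T A′ − A′ = −H(C(T A′))`.
[cite: Balaban1985Variational, (48)–(49) p.285] -/
theorem T47_sub_self (RC : Regime H 0 C b 0 C₂ c₄ 0 aC εC) {A' : Space115 L η lev₀ lev₁ Dc} (hA' : ‖A'‖ < aC) :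
    T47 H C εC A' - A' = -H (C (T47 H C εC A')) := by
  have h := (RC.solA_mem (J := 0) (by rw [norm_zero]) hA').2
  rw [mapT_158] at h
  rw [T47_apply, add_sub_cancel_left, add_comm A']
  exact h.symm

/-- `T 0 = 0` (`HD(0) = 0`). [cite: Balaban1985Variational, (47) p.285, (55) p.286] -/
theorem T47_zero (RC : Regime H 0 C b 0 C₂ c₄ 0 aC εC) (haC : 0 < aC) : T47 H C εC (0 : Space115 L η lev₀ lev₁ Dc) = 0 := by
  rw [T47_apply, RC.solA_zero le_rfl haC, add_zero]

/-- The range bound: `‖A‖ < ε_C + a_C` on `‖A′‖ < a_C` ((57)-type). [cite: Balaban1985Variational, (57) p.286] -/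
theorem norm_T47_lt (RC : Regime H 0 C b 0 C₂ c₄ 0 aC εC) {A' : Space115 L η lev₀ lev₁ Dc} (hA' : ‖A'‖ < aC) :
    ‖T47 H C εC A'‖ < εC + aC := by
  rw [T47_apply]
  calc ‖A' + solA H 0 C 0 εC A'‖ ≤ ‖A'‖ + ‖solA H 0 C 0 εC A'‖ := norm_add_le _ _
    _ < aC + εC := add_lt_add_of_lt_of_le hA' (norm_solA_le RC hA')
    _ = εC + aC := add_comm _ _

/-- **THE LINEAR BOUND (57): `‖A‖ ≤ ‖A′‖/(1 − 4bC₂(ε_C + a_C))`** on `‖A′‖ < a_C` — from the Lipschitz dependence of the fixed point on the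
datum (`T4FixedPointResponse.norm_solution_sub_le_data` at the data `A′` and `0`, where the solution is `0`).
[cite: Balaban1985Variational, (54) p.286, (57) p.286] -/
theorem norm_T47_le (RC : Regime H 0 C b 0 C₂ c₄ 0 aC εC) {A' : Space115 L η lev₀ lev₁ Dc} (hA' : ‖A'‖ < aC) :
    ‖T47 H C εC A'‖ ≤ ‖A'‖ / (1 - 4 * b * C₂ * (εC + aC)) := by
  have haC : 0 < aC := (norm_nonneg _).trans_lt hA'
  have hm := RC.solA_mem (J := 0) (by rw [norm_zero]) hA'
  have hq : 0 + 4 * b * C₂ * (εC + aC) < 1 := RC.contr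
  have h0 : mapT H 0 C (0 : 𝒳) (0 : Space115 L η lev₀ lev₁ Dc) 0 = 0 := by
    rw [mapT_158, zero_add, RC.map_zero haC, map_zero, neg_zero]
  have h := T4FixedPointResponse.norm_solution_sub_le_data (J₁ := (0 : 𝒳)) (J₂ := (0 : 𝒳)) (𝔄₂ := (0 : Space115 L η lev₀ lev₁ Dc))
    (X₂ := (0 : Space115 L η lev₀ lev₁ Dc)) RC.norm_G RC.norm_L RC.quad RC.B₀_nonneg RC.C₄_nonneg hA' (by rw [norm_zero]; exact haC)
    RC.ε₄_nonneg RC.dom RC.contr hm.1 (by rw [norm_zero]; exact RC.ε₄_nonneg) hm.2 h0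
  rw [sub_zero, sub_zero, sub_zero, map_zero, norm_zero, zero_add, zero_add] at h
  have h1q : 0 < 1 - 4 * b * C₂ * (εC + aC) := by linarith
  rw [T47_apply]
  calc ‖A' + solA H 0 C 0 εC A'‖ ≤ ‖A'‖ + ‖solA H 0 C 0 εC A'‖ := norm_add_le _ _
    _ ≤ ‖A'‖ + 4 * b * C₂ * (εC + aC) * ‖A'‖ / (1 - 4 * b * C₂ * (εC + aC)) := by
        have h' : ‖solA H 0 C 0 εC A'‖ ≤ 4 * b * C₂ * (εC + aC) * ‖A'‖ / (1 - 4 * b * C₂ * (εC + aC)) := by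
          simpa only [zero_add] using h
        linarith
    _ = ‖A'‖ / (1 - 4 * b * C₂ * (εC + aC)) := by
        rw [eq_div_iff h1q.ne', add_mul, div_mul_cancel₀ _ h1q.ne']
        ring

/-! ## §2 The map (47) is Fréchet-holomorphic on its ball — IN LITERATURE (Graves–Taylor–Hille–Zorn) -/

/-- **`A′ ↦ −HD(A′)` IS FRÉCHET-DIFFERENTIABLE ON THE BALL `‖A′‖ < a_C`** (p. 286: «it is an analytic function of A′»): lit-balaban's
`Regime.solA_differentiableOn` gives holomorphy along every complex line (G-holomorphy), the solution is bounded by `ε_C`, and a bounded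
G-holomorphic map on a ball of a complex normed space is holomorphic (the tree's Graves–Taylor–Hille–Zorn theorem
`Literature.Analysis.Complex.GateauxHolomorphic.differentiableOn_of_gateaux_of_bounded`). [cite: Balaban1985Variational, p.286, Prop. 3 p.289] -/
theorem differentiableOn_solA (RC : Regime H 0 C b 0 C₂ c₄ 0 aC εC) (hC : Prop4Hyp C C₂ c₄) :
    DifferentiableOn ℂ (solA H 0 C 0 εC) (ball (0 : Space115 L η lev₀ lev₁ Dc) aC) := by
  refine Literature.Analysis.Complex.GateauxHolomorphic.differentiableOn_of_gateaux_of_bounded (M := εC) ?_ ?_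
  · intro a _ v
    have hline : Differentiable ℂ (fun z : ℂ => a + z • v) := (differentiable_const a).add (differentiable_id.smul_const v)
    have hV : IsOpen {z : ℂ | a + z • v ∈ ball (0 : Space115 L η lev₀ lev₁ Dc) aC} := isOpen_ball.preimage hline.continuous
    exact RC.solA_differentiableOn hC hV (differentiableOn_const (0 : 𝒳)) hline.differentiableOn
      (fun _ _ => by rw [norm_zero]) (fun z hz => mem_ball_zero_iff.1 hz)
  · intro y hy
    exact norm_solA_le RC (mem_ball_zero_iff.1 hy)

/-- **The map (47) is Fréchet-differentiable on `‖A′‖ < a_C`.** [cite: Balaban1985Variational, p.286, Prop. 3 p.289] -/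
theorem differentiableOn_T47 (RC : Regime H 0 C b 0 C₂ c₄ 0 aC εC) (hC : Prop4Hyp C C₂ c₄) :
    DifferentiableOn ℂ (T47 H C εC) (ball (0 : Space115 L η lev₀ lev₁ Dc) aC) :=
  differentiableOn_id.add (differentiableOn_solA RC hC)

/-- **The map (47) is ANALYTIC on `‖A′‖ < a_C`** (finite-dimensional carrier: holomorphic ⇒ analytic, the tree's Osgood lemma
`Literature.Analysis.Complex.SCV.analyticOnNhd_of_differentiableOn`) — Prop. 3: «The transformation (47) … is defined and analytic».
[cite: Balaban1985Variational, Prop. 3 p.289] -/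
theorem analyticOnNhd_T47 (RC : Regime H 0 C b 0 C₂ c₄ 0 aC εC) (hC : Prop4Hyp C C₂ c₄) :
    AnalyticOnNhd ℂ (T47 H C εC) (ball (0 : Space115 L η lev₀ lev₁ Dc) aC) :=
  Literature.Analysis.Complex.SCV.analyticOnNhd_of_differentiableOn (differentiableOn_T47 RC hC) isOpen_ball

/-- The derivative of (47): `T′(A′) = 1 + (−HD)′(A′)` (print: `1 − H𝔇(A′)`, `𝔇 = (δ/δA′)D` of (63)) on the ball.
[cite: Balaban1985Variational, (63) p.287, (90) p.291] -/
theorem fderiv_T47 (RC : Regime H 0 C b 0 C₂ c₄ 0 aC εC) (hC : Prop4Hyp C C₂ c₄) {A' : Space115 L η lev₀ lev₁ Dc} (hA' : ‖A'‖ < aC) :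
    fderiv ℂ (T47 H C εC) A' = ContinuousLinearMap.id ℂ _ + fderiv ℂ (solA H 0 C 0 εC) A' := by
  have hd : DifferentiableAt ℂ (solA H 0 C 0 εC) A' :=
    (differentiableOn_solA RC hC).differentiableAt (isOpen_ball.mem_nhds (mem_ball_zero_iff.2 hA'))
  rw [T47_eq]
  exact ((hasFDerivAt_id A').add hd.hasFDerivAt).fderiv

end RegimeC

/-! ## §3 The V₀-group of `(δ/δA′)V` AT `A′`: (90) with its `−𝔇*(A′)H*` term and the HD(A′)-insertion terms of p. 292, all at once -/

section V0Group

variable [FiniteDimensional ℂ 𝔸] [CompleteSpace 𝔸] {H : 𝒳 →L[ℂ] Space115 L η lev₀ lev₁ Dc} {C : Space115 L η lev₀ lev₁ Dc → 𝒳}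
  {b C₂ c₄ aC εC : ℝ}

/-- **THE V₀-GROUP OF `W = (δ/δA′)V` AT `A′`, COMPOSED WITH (47)** — print's (90) `Σ_{p∈st(b)}(∂/∂A(b))V′₀(A′ − HD(A′), ∂p) −
𝔇*(A′)H*Σ_{p∈st(·)}(∂/∂A(·))V′₀(A′ − HD(A′), ∂p)` TOGETHER WITH the commutator group (91)–(96) and p. 292's «terms obtained by replacing some
A′ in the commutator by −HD(A′)»: the pullback `(T′(A′))ᵗ curV0(T A′)` of this lineage's V₀-current `curV0 = curV0prime + curComm`
(`B11Eq63V0GroupCurrent`, the (63)-current of r08's WHOLE `V₀` of (26)) along the Sect. C map `T` = (47); `(T′(A′))ᵗ = 1 − 𝔇*(A′)H*`.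
A map `Space115 L η lev₀ lev₁ Dc → NegSize L η lev₀ 3 𝔸` — the W-slot type of the owner's `cur_chart_exists_of_W_H126`.
[cite: Balaban1985Variational, (90) p.291, (91)–(96) p.292, (80) p.290] -/
def curV0full (ρ : (𝔸 →L[ℂ] ℂ) →L[ℂ] 𝔸) (τ : 𝔸 →L[ℂ] ℂ) (U₀ : Bond d Pd → 𝔸ˣ) (H : 𝒳 →L[ℂ] Space115 L η lev₀ lev₁ Dc)
    (C : Space115 L η lev₀ lev₁ Dc → 𝒳) (εC : ℝ) : Space115 L η lev₀ lev₁ Dc → NegSize L η lev₀ 3 𝔸 :=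
  pullCur ρ τ (T47 H C εC) (curV0 (lev₁ := lev₁) (Dc := Dc) ρ τ U₀)

omit [CompleteSpace 𝔸] in
/-- Unfolding. [cite: Balaban1985Variational, (90) p.291] -/
theorem curV0full_apply (ρ : (𝔸 →L[ℂ] ℂ) →L[ℂ] 𝔸) (τ : 𝔸 →L[ℂ] ℂ) (U₀ : Bond d Pd → 𝔸ˣ) (εC : ℝ) (A' : Space115 L η lev₀ lev₁ Dc) :
    curV0full ρ τ U₀ H C εC A' = transCur ρ τ (fderiv ℂ (T47 H C εC) A') (curV0 (lev₁ := lev₁) (Dc := Dc) ρ τ U₀ (T47 H C εC A')) := rfl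

omit [FiniteDimensional ℂ 𝔸] in
/-- `V₀` of (26) is an entire function of the configuration (p. 282: «an analytic, and even an entire function of A»; by (30) and the `Cⁿ`
regularity of each `V₀(A, ∂p)`). [cite: Balaban1985Variational, p.282, (30) p.282] -/
theorem differentiable_V0 (τ : 𝔸 →L[ℂ] ℂ) (hτ : ∀ a b : 𝔸, τ (a * b) = τ (b * a)) (hd : 4 ≤ d) (U₀ : Bond d Pd → 𝔸ˣ) :
    Differentiable ℂ (V0 Tsh (Ucur U₀) η d (τ : 𝔸 →ₗ[ℂ] ℂ) : (Fin d → TSite d Pd → 𝔸) → ℂ) := by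
  have hη : (η : ℝ) ≠ 0 := (Fact.out : 0 < η).ne'
  have e : (V0 Tsh (Ucur U₀) η d (τ : 𝔸 →ₗ[ℂ] ℂ) : (Fin d → TSite d Pd → 𝔸) → ℂ)
      = fun A => ∑ q ∈ posPlaq (TSite d Pd) (Fin d), (η : ℂ) ^ d * V0p Tsh (Ucur U₀) η (τ : 𝔸 →ₗ[ℂ] ℂ) A q.2.1 q.2.2 q.1 :=
    funext fun A => eq30a Tsh (Ucur U₀) (τ : 𝔸 →ₗ[ℂ] ℂ) hτ η hη hd A
  rw [e]
  exact Differentiable.fun_sum fun q _ =>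
    (((contDiff_V0p Tsh (Ucur U₀) (n := 1) η τ q.2.1 q.2.2 q.1).differentiable one_ne_zero).const_mul _)

/-- **(63) FOR THE COMPOSED V₀-GROUP — THE PAIRING CERTIFICATE**: for `‖A′‖ < a_C` (Sect. C regime, `C` of Prop.-4 type on its ball), a
tracial `τ`, the dualising identity `τ(ρ(ℓ)X) = ℓ X`, `d ≥ 4`: `⟨curV0full(A′), δ⟩ = (d/dt) V₀(T(A′ + tδ))|_{t=0}` with `V₀ =
B11Eq26ActionExpansion.V0` of (26) and `T` = (47) — i.e. `curV0full` IS `(δ/δA′) V₀(A′ − HD(A′))`, the last term of (80) differentiated at `A′`.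
[cite: Balaban1985Variational, (63) p.287, (80) p.290, (90) p.291] -/
theorem pair27_curV0full (ρ : (𝔸 →L[ℂ] ℂ) →L[ℂ] 𝔸) (τ : 𝔸 →L[ℂ] ℂ)
    (hρ : ∀ (ℓ : 𝔸 →L[ℂ] ℂ) (X : 𝔸), τ (ρ ℓ * X) = ℓ X) (hτ : ∀ a b : 𝔸, τ (a * b) = τ (b * a)) (hd : 4 ≤ d)
    (U₀ : Bond d Pd → 𝔸ˣ) (RC : Regime H 0 C b 0 C₂ c₄ 0 aC εC) (hC : Prop4Hyp C C₂ c₄) {A' : Space115 L η lev₀ lev₁ Dc}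
    (hA' : ‖A'‖ < aC) (δ : Bond d Pd → 𝔸) :
    pair27 τ (curV0full ρ τ U₀ H C εC A') δ
      = deriv (fun t : ℂ => V0 Tsh (Ucur U₀) η d (τ : 𝔸 →ₗ[ℂ] ℂ)
          (curL (flat115 (T47 H C εC (A' + t • (JetSup.equiv (levWeight L η lev₀ 1) (levWeight L η lev₁ 2) Dc).symm δ))))) 0 := by
  have hT : DifferentiableAt ℂ (T47 H C εC) A' :=
    (differentiableOn_T47 RC hC).differentiableAt (isOpen_ball.mem_nhds (mem_ball_zero_iff.2 hA'))
  have hF : Differentiable ℂ (fun Y : Space115 L η lev₀ lev₁ Dc => V0 Tsh (Ucur U₀) η d (τ : 𝔸 →ₗ[ℂ] ℂ) (curL (flat115 Y))) :=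
    (differentiable_V0 τ hτ hd U₀).comp
      (((curL : (Bond d Pd → 𝔸) →L[ℂ] (Fin d → TSite d Pd → 𝔸)).comp
        (flat115 (L := L) (η := η) (lev₀ := lev₀) (lev₁ := lev₁) (Dc := Dc))).differentiable)
  refine pair27_pullCur ρ τ hρ (F := fun Y => V0 Tsh (Ucur U₀) η d (τ : 𝔸 →ₗ[ℂ] ℂ) (curL (flat115 Y))) (fun δ' => ?_) hT (hF _) δ
  -- the (63)-certificate of `curV0` (`B11Eq63V0GroupCurrent.bondPair_curV0`); `flat115 (Y + tδ) = flat115 Y + t·δ`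
  rw [pair27_def, bondPair_curV0 (lev₁ := lev₁) (Dc := Dc) ρ τ hρ hτ hd U₀ _ δ']
  exact congrArg (fun f : ℂ → ℂ => deriv f 0)
    (funext fun t => by simp only [map_add, map_smul, flat115_apply, Equiv.apply_symm_apply])

/-- **THE COMPOSED V₀-GROUP IS DIFFERENTIABLE ON THE BALL `‖A′‖ < a_C`** (Prop. 4: «The functional derivative of V(A′) is an analytic function
on this space», for this group). [cite: Balaban1985Variational, Prop. 4 p.292] -/
theorem differentiableOn_curV0full (ρ : (𝔸 →L[ℂ] ℂ) →L[ℂ] 𝔸) (τ : 𝔸 →L[ℂ] ℂ) (U₀ : Bond d Pd → 𝔸ˣ)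
    (RC : Regime H 0 C b 0 C₂ c₄ 0 aC εC) (hC : Prop4Hyp C C₂ c₄) :
    DifferentiableOn ℂ (curV0full ρ τ U₀ H C εC) (ball (0 : Space115 L η lev₀ lev₁ Dc) aC) := by
  have hcur : Differentiable ℂ (curV0 (L := L) (η := η) (lev₀ := lev₀) (lev₁ := lev₁) (Dc := Dc) ρ τ U₀) :=
    (differentiable_curV0prime (lev₁ := lev₁) (Dc := Dc) ρ τ U₀).add (differentiable_curComm (lev₁ := lev₁) (Dc := Dc) ρ τ U₀)
  exact differentiableOn_pullCur ρ τ (analyticOnNhd_T47 RC hC) (mapsTo_univ _ _) hcur.differentiableOn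

/-- **… AND ANALYTIC THERE** (finite-dimensional carrier; the `AnalyticOnNhd` clause of the owner's W-slot, on the ball).
[cite: Balaban1985Variational, Prop. 4 p.292] -/
theorem analyticOnNhd_curV0full (ρ : (𝔸 →L[ℂ] ℂ) →L[ℂ] 𝔸) (τ : 𝔸 →L[ℂ] ℂ) (U₀ : Bond d Pd → 𝔸ˣ)
    (RC : Regime H 0 C b 0 C₂ c₄ 0 aC εC) (hC : Prop4Hyp C C₂ c₄) :
    AnalyticOnNhd ℂ (curV0full ρ τ U₀ H C εC) (ball (0 : Space115 L η lev₀ lev₁ Dc) aC) :=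
  Literature.Analysis.Complex.SCV.analyticOnNhd_of_differentiableOn (differentiableOn_curV0full ρ τ U₀ RC hC) isOpen_ball

end V0Group

/-! ## §4 The kernel column of `T′(A′) = 1 − H𝔇(A′)` and the (98)-form slot of the composed V₀-group -/

section Slots

variable [FiniteDimensional ℂ 𝔸]

/-- The kernel is additive in the operator. [cite: Balaban1985Variational, (85) p.291] -/
theorem kernel_add (M₁ M₂ : Space115 L η lev₀ lev₁ Dc →L[ℂ] Space115 L η lev₀ lev₁ Dc) (b' b : Bond d Pd) :
    kernel (M₁ + M₂) b' b = kernel M₁ b' b + kernel M₂ b' b := by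
  ext X
  simp only [kernel_apply, add_apply, map_add, Pi.add_apply]

/-- The kernel of the identity is the unit matrix: `k_1(b′, b)X = δ_{b′b}X`. [cite: Balaban1985Variational, (63) p.287] -/
theorem kernel_id_apply (b' b : Bond d Pd) (X : 𝔸) :
    kernel (ContinuousLinearMap.id ℂ (Space115 L η lev₀ lev₁ Dc)) b' b X = (Pi.single b X : Bond d Pd → 𝔸) b' := rfl

/-- The weighted column of the identity kernel is `≤ 1`. [cite: Balaban1985Variational, (90) p.291] -/
theorem colSum_kernel_id_le_one (b : Bond d Pd) :
    ∑ b' : Bond d Pd, levWeight L η lev₀ 3 b / levWeight L η lev₀ 3 b'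
        * ‖kernel (ContinuousLinearMap.id ℂ (Space115 L η lev₀ lev₁ Dc)) b' b‖ ≤ 1 := by
  classical
  have hw : ∀ b : Bond d Pd, 0 < levWeight L η lev₀ 3 b := levWeight_pos (Fact.out : 0 < L) (Fact.out : 0 < η) lev₀ 3
  rw [Finset.sum_eq_single b]
  · rw [div_self (hw b).ne', one_mul]
    refine ContinuousLinearMap.opNorm_le_bound _ zero_le_one fun X => ?_
    rw [kernel_id_apply, Pi.single_eq_same, one_mul]
  · intro b' _ hb'
    have h0 : kernel (ContinuousLinearMap.id ℂ (Space115 L η lev₀ lev₁ Dc)) b' b = 0 := by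
      ext X; rw [kernel_id_apply, Pi.single_eq_of_ne hb', _root_.zero_apply]
    rw [h0, norm_zero, mul_zero]
  · intro h; exact absurd (Finset.mem_univ b) h

variable {H : 𝒳 →L[ℂ] Space115 L η lev₀ lev₁ Dc} {C : Space115 L η lev₀ lev₁ Dc → 𝒳} {b C₂ c₄ aC εC : ℝ}

/-- **THE COLUMN LETTER OF `T′(A′)`**: if the kernel of `(−HD)′(A′) = −H𝔇(A′)` has weighted columns `≤ Θ` (print: the kernel bounds (46) for
`H` and (73) for `𝔇(A′; c, b)` with their exponential decay), then the kernel of `T′(A′) = 1 − H𝔇(A′)` has weighted columns `≤ 1 + Θ`.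
[cite: Balaban1985Variational, (46) p.285, (73) p.289, (90) p.291] -/
theorem colSum_kernel_fderiv_T47_le (RC : Regime H 0 C b 0 C₂ c₄ 0 aC εC) (hC : Prop4Hyp C C₂ c₄) {A' : Space115 L η lev₀ lev₁ Dc}
    (hA' : ‖A'‖ < aC) {Θ : ℝ}
    (hΘ : ∀ b : Bond d Pd, ∑ b' : Bond d Pd, levWeight L η lev₀ 3 b / levWeight L η lev₀ 3 b'
      * ‖kernel (fderiv ℂ (solA H 0 C 0 εC) A') b' b‖ ≤ Θ) (b : Bond d Pd) :
    ∑ b' : Bond d Pd, levWeight L η lev₀ 3 b / levWeight L η lev₀ 3 b' * ‖kernel (fderiv ℂ (T47 H C εC) A') b' b‖ ≤ 1 + Θ := by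
  have hw : ∀ b : Bond d Pd, 0 < levWeight L η lev₀ 3 b := levWeight_pos (Fact.out : 0 < L) (Fact.out : 0 < η) lev₀ 3
  rw [fderiv_T47 RC hC hA']
  calc ∑ b' : Bond d Pd, levWeight L η lev₀ 3 b / levWeight L η lev₀ 3 b'
          * ‖kernel (ContinuousLinearMap.id ℂ _ + fderiv ℂ (solA H 0 C 0 εC) A') b' b‖
      ≤ ∑ b' : Bond d Pd, (levWeight L η lev₀ 3 b / levWeight L η lev₀ 3 b'
          * ‖kernel (ContinuousLinearMap.id ℂ (Space115 L η lev₀ lev₁ Dc)) b' b‖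
          + levWeight L η lev₀ 3 b / levWeight L η lev₀ 3 b' * ‖kernel (fderiv ℂ (solA H 0 C 0 εC) A') b' b‖) := by
        refine Finset.sum_le_sum fun b' _ => ?_
        rw [kernel_add, ← mul_add]
        exact mul_le_mul_of_nonneg_left (norm_add_le _ _) (div_nonneg (hw b).le (hw b').le)
    _ ≤ 1 + Θ := by rw [Finset.sum_add_distrib]; exact add_le_add (colSum_kernel_id_le_one b) (hΘ b)

variable [CompleteSpace 𝔸]

/-- **THE (98)-FORM SLOT OF THE COMPOSED V₀-GROUP** — `Prop4Hyp (curV0full …) C′ R′` (the `Regime.quad`/`prop4` field type of the Sect. E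
scheme, at the W-slot carrier): from the V₀-group's own slot READ AT `A` (`QuadAnalytic (curV0 ρ τ U₀) C_V R_V`, PROVED under its displays in
`B11Eq63V0GroupCurrent.quadAnalytic_curV0`), the Sect. C regime of (47) with `C` of Prop.-4 type, the column letter `Θ` of `H𝔇(A′)` on the
ball, and a radius `R′ ≤ a_C` with `R′ ≤ (1 − 4bC₂(ε_C + a_C))·R_V` (so that `‖A‖ < R_V` by (57)):
`‖curV0full(A′)‖₍₋₃₎ ≤ ‖ρ‖‖τ‖(1 + Θ)·C_V·(1 − 4bC₂(ε_C + a_C))⁻²·‖A′‖²` on `‖A′‖ < R′`, and analyticity there.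
[cite: Balaban1985Variational, Prop. 4 (97)–(98) pp.292–293, (90) p.291, (57) p.286] -/
theorem prop4Hyp_curV0full (ρ : (𝔸 →L[ℂ] ℂ) →L[ℂ] 𝔸) (τ : 𝔸 →L[ℂ] ℂ) (U₀ : Bond d Pd → 𝔸ˣ) {CV RV : ℝ}
    (hq : B13Contraction113.QuadAnalytic (curV0 (L := L) (η := η) (lev₀ := lev₀) (lev₁ := lev₁) (Dc := Dc) ρ τ U₀) CV RV)
    (hCV : 0 ≤ CV) (RC : Regime H 0 C b 0 C₂ c₄ 0 aC εC) (hC : Prop4Hyp C C₂ c₄) {Θ R' : ℝ} (hΘ0 : 0 ≤ Θ)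
    (hΘ : ∀ A' : Space115 L η lev₀ lev₁ Dc, ‖A'‖ < R' → ∀ b : Bond d Pd,
      ∑ b' : Bond d Pd, levWeight L η lev₀ 3 b / levWeight L η lev₀ 3 b' * ‖kernel (fderiv ℂ (solA H 0 C 0 εC) A') b' b‖ ≤ Θ)
    (hR'a : R' ≤ aC) (hR'V : R' ≤ (1 - 4 * b * C₂ * (εC + aC)) * RV) :
    Prop4Hyp (curV0full ρ τ U₀ H C εC)
      (‖ρ‖ * ‖τ‖ * (1 + Θ) * CV * (1 / (1 - 4 * b * C₂ * (εC + aC))) ^ 2) R' := by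
  have h1q : 0 < 1 - 4 * b * C₂ * (εC + aC) := by linarith [RC.contr]
  have hcur : Differentiable ℂ (curV0 (L := L) (η := η) (lev₀ := lev₀) (lev₁ := lev₁) (Dc := Dc) ρ τ U₀) :=
    (differentiable_curV0prime (lev₁ := lev₁) (Dc := Dc) ρ τ U₀).add (differentiable_curComm (lev₁ := lev₁) (Dc := Dc) ρ τ U₀)
  have hball : ∀ A' : Space115 L η lev₀ lev₁ Dc, ‖A'‖ < R' → ‖A'‖ < aC := fun A' hA' => lt_of_lt_of_le hA' hR'a
  have hℓ : ∀ A' : Space115 L η lev₀ lev₁ Dc, ‖A'‖ < R' →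
      ‖T47 H C εC A'‖ ≤ 1 / (1 - 4 * b * C₂ * (εC + aC)) * ‖A'‖ := fun A' hA' => by
    rw [one_div_mul_eq_div]; exact norm_T47_le RC (hball A' hA')
  have hR : ∀ A' : Space115 L η lev₀ lev₁ Dc, ‖A'‖ < R' → ‖T47 H C εC A'‖ < RV := fun A' hA' => by
    refine lt_of_le_of_lt (norm_T47_le RC (hball A' hA')) ?_
    rw [div_lt_iff₀ h1q]
    calc ‖A'‖ < R' := hA'
      _ ≤ (1 - 4 * b * C₂ * (εC + aC)) * RV := hR'V
      _ = RV * (1 - 4 * b * C₂ * (εC + aC)) := mul_comm _ _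
  have hΦ : AnalyticOnNhd ℂ (T47 H C εC) {A' : Space115 L η lev₀ lev₁ Dc | ‖A'‖ < R'} :=
    (analyticOnNhd_T47 RC hC).mono fun A' hA' => mem_ball_zero_iff.2 (hball A' hA')
  exact prop4Hyp_pullCur ρ τ (by positivity) hCV hq.quad (hcur.differentiableOn) hΦ hR hℓ
    (fun A' hA' b₀ => colSum_kernel_fderiv_T47_le RC hC (hball A' hA') (hΘ A' hA') b₀)

/-- **THE OWNER's W-SLOT CLAUSES FOR THE COMPOSED V₀-GROUP**, in the letters of `cur_chart_exists_of_W_H126` (`QuadAnalytic Wq C₄ a₃`,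
`AnalyticOnNhd ℂ Wq {‖Y‖ < a₃}`), under the hypotheses of `prop4Hyp_curV0full`. [cite: Balaban1985Variational, Prop. 4 (98) p.293, (120) p.295] -/
theorem quadAnalytic_curV0full (ρ : (𝔸 →L[ℂ] ℂ) →L[ℂ] 𝔸) (τ : 𝔸 →L[ℂ] ℂ) (U₀ : Bond d Pd → 𝔸ˣ) {CV RV : ℝ}
    (hq : B13Contraction113.QuadAnalytic (curV0 (L := L) (η := η) (lev₀ := lev₀) (lev₁ := lev₁) (Dc := Dc) ρ τ U₀) CV RV)
    (hCV : 0 ≤ CV) (RC : Regime H 0 C b 0 C₂ c₄ 0 aC εC) (hC : Prop4Hyp C C₂ c₄) {Θ R' : ℝ} (hΘ0 : 0 ≤ Θ)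
    (hΘ : ∀ A' : Space115 L η lev₀ lev₁ Dc, ‖A'‖ < R' → ∀ b : Bond d Pd,
      ∑ b' : Bond d Pd, levWeight L η lev₀ 3 b / levWeight L η lev₀ 3 b' * ‖kernel (fderiv ℂ (solA H 0 C 0 εC) A') b' b‖ ≤ Θ)
    (hR'a : R' ≤ aC) (hR'V : R' ≤ (1 - 4 * b * C₂ * (εC + aC)) * RV) :
    B13Contraction113.QuadAnalytic (curV0full ρ τ U₀ H C εC)
        (‖ρ‖ * ‖τ‖ * (1 + Θ) * CV * (1 / (1 - 4 * b * C₂ * (εC + aC))) ^ 2) R' ∧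
      AnalyticOnNhd ℂ (curV0full ρ τ U₀ H C εC) {Y : Space115 L η lev₀ lev₁ Dc | ‖Y‖ < R'} :=
  ⟨(prop4Hyp_curV0full ρ τ U₀ hq hCV RC hC hΘ0 hΘ hR'a hR'V).quadAnalytic,
    (analyticOnNhd_curV0full ρ τ U₀ RC hC).mono fun _ hY => mem_ball_zero_iff.2 (lt_of_lt_of_le hY hR'a)⟩

end Slots

end Literature.MathematicalPhysics.QuantumFieldTheory.Balaban1983to89.B11Eq90V0GroupComposed

end
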